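import Mathlib
import HarnessLib
import Summits.FinalStateConjecture.FinalStateConjecture.Statement
import Summits.FinalStateConjecture.FinalStateConjecture.Theorems.ClusterCompletenessRecurrentlyFlatDispersesSlabCauchyExit
import Literature.Geometry.Manifold.InverseFunctionTheorem
import Literature.Geometry.Lorentzian.NullRayNonImprisonment
import Literature.Geometry.Lorentzian.CauchyDevelopmentGlobalHyperbolicityProofs
import Literature.Geometry.Lorentzian.CauchyHypersurfaceCausalProofs
import Literature.Geometry.Lorentzian.HypersurfaceShadowDomainCauchy

/-!
# Crux `RecurrentlyFlatDisperses` (stmt-FinalStateConjecture-14665), line `Sketch`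
# (card `outgoing-blind-cup-restart`) — registered stub `stub_slabCauchy`

SLAB CAUCHY (domain of dependence of a late slab): given the pointwise anchor (`AnchorCone`), the orientation of the
chart time (`ChartFuture`) and the future-set property (`FutureSet`) as hypotheses, for every `τ > τ₀` every
future-directed causal curve `γ` on an order-connected parameter set `s` which is PAST-ENDLESS and passes at
parameter `t` through a point of the chart above the slab, `Ψ₀{x⁰ > τ}`, meets the slab `Ψ₀{x⁰ = τ}` at some
parameter `t' ≤ t`. Proof: let `t*` be the infimum of the parameters `u ≤ t` with `γ([u, t]) ⊆ Ψ₀{x⁰ > τ}` (an open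
set); inside, the lifted curve has chart time decreasing towards the past with bounded spatial drift (cone of a form
within `1/4` of `η`), so (a) if `t* ∈ s` the lift converges as `u ↓ t*` to a point `z*` of the closed half-space
`{x⁰ ≥ τ}` inside the late region, and `γ t* = Ψ₀ z*` (Hausdorff limit) is either charted above `τ` — impossible
by minimality of `t*` and openness — or ON the slab; (b) if the whole past ray stays charted above `τ`, it is a
past-endless causal curve inside the compact `J⁺(Σ) ∩ J⁻(γ t)` (chart image `⊆ O ⊆ J⁺(Σ)`), i.e. a future-endless
causal curve for the reversed orientation imprisoned in a compact set of the strongly causal reversed development —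
contradiction (`IsGloballyHyperbolic.reverse`, Bernal–Sánchez, `IsStronglyCausal.exists_forall_notMem_of_isCompact_holds`).
The causal cone estimate, the lift and the convergence of the lift at the past exit parameter are the support file
`…Theorems.ClusterCompletenessRecurrentlyFlatDispersesSlabCauchyExit` (namespace `…RecurrentlyFlatDisperses.SlabCauchy`);
the chart `Φ = Ψ₀|{x⁰ > τ₀}` is set up as for the neighbour `stub_futureSet` (an injective local diffeomorphism by the
anchor and the inverse function theorem). The third hypothesis (`FutureSet`) is carried by the registered signature but
not needed: openness of the chart above the slab and the causal cone of the anchored chart suffice. Mathlib + the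
Literature cone only; no definitions, no named facts.
-/

noncomputable section

open scoped Manifold ContDiff Topology
open Bundle Filter Set Function TopologicalSpace Literature.Geometry.Lorentzian

namespace Summit.FinalStateConjecture.FinalStateConjecture.Theorems.RecurrentlyFlatDisperses

/-! ### Regularity side condition -/

/-- `2 ≤ ∞` in `ℕ∞ω` (regularity side condition of the causality theorems). -/
private lemma two_le_infty : (2 : ℕ∞ω) ≤ ∞ := WithTop.coe_le_coe.mpr le_top

/-! ### The stub -/

/-- **Late slabs are met by every past-endless causal curve from the chart above them** (registered stub
`stub_slabCauchy` of crux stmt-FinalStateConjecture-14665, `AnchorCone → ChartFuture → FutureSet → SlabCauchy` unfolded). -/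
theorem stub_slabCauchy :
    (∀ (X : Type) [TopologicalSpace X] [ChartedSpace E3 X] [IsManifold (𝓡 3) ∞ X] [T2Space X]
      [SecondCountableTopology X] [ConnectedSpace X],
      ∀ D ∈ admissibleVacuumData X, ∀ 𝒟 : VacuumCauchyDevelopment D, 𝒟.IsMaximal →
        ∀ (O : Set 𝒟.carrier) (τ₀ : ℝ) (U₀ : Opens E4) (Ψ₀ : U₀ → 𝒟.carrier),
          (𝒟.toSpacetime.IsLateChart (Minkowski.backgroundOn U₀) O τ₀ Ψ₀ ∧
            {x : E4 | τ₀ < x 0} ⊆ (U₀ : Set E4) ∧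
            O = Summit.FinalStateConjecture.exteriorOf 𝒟.toCauchyDevelopment
              (Ψ₀ '' (Minkowski.backgroundOn U₀).lateRegion τ₀) ∧
            (∀ τ₁ : ℝ, τ₀ < τ₁ → O \ Ψ₀ '' (Minkowski.backgroundOn U₀).lateRegion τ₁ ⊆
              𝒟.metric.causalPast 𝒟.timeOrientation
                (Ψ₀ '' (Minkowski.backgroundOn U₀).timeSlab τ₁)) ∧
            (∀ τ : ℝ, τ₀ < τ → 𝒟.toSpacetime.deviationCk (Minkowski.backgroundOn U₀) Ψ₀ 0 τ ≤
              ENNReal.ofReal (1 / 4))) →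
          (∀ x : U₀, τ₀ < x.1 0 →
            ‖𝒟.toSpacetime.deviation (Minkowski.backgroundOn U₀) Ψ₀ x‖ ≤ 1 / 4)) →
    (∀ (X : Type) [TopologicalSpace X] [ChartedSpace E3 X] [IsManifold (𝓡 3) ∞ X] [T2Space X]
      [SecondCountableTopology X] [ConnectedSpace X],
      ∀ D ∈ admissibleVacuumData X, ∀ 𝒟 : VacuumCauchyDevelopment D, 𝒟.IsMaximal →
        ∀ (O : Set 𝒟.carrier) (τ₀ : ℝ) (U₀ : Opens E4) (Ψ₀ : U₀ → 𝒟.carrier),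
          (𝒟.toSpacetime.IsLateChart (Minkowski.backgroundOn U₀) O τ₀ Ψ₀ ∧
            {x : E4 | τ₀ < x 0} ⊆ (U₀ : Set E4) ∧
            O = Summit.FinalStateConjecture.exteriorOf 𝒟.toCauchyDevelopment
              (Ψ₀ '' (Minkowski.backgroundOn U₀).lateRegion τ₀) ∧
            (∀ τ₁ : ℝ, τ₀ < τ₁ → O \ Ψ₀ '' (Minkowski.backgroundOn U₀).lateRegion τ₁ ⊆
              𝒟.metric.causalPast 𝒟.timeOrientation
                (Ψ₀ '' (Minkowski.backgroundOn U₀).timeSlab τ₁)) ∧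
            (∀ τ : ℝ, τ₀ < τ → 𝒟.toSpacetime.deviationCk (Minkowski.backgroundOn U₀) Ψ₀ 0 τ ≤
              ENNReal.ofReal (1 / 4))) →
          (∀ x : U₀, τ₀ < x.1 0 →
            𝒟.timeOrientation.IsFutureDirected
              (mfderiv 𝓘(ℝ, E4) (𝓡 4) Ψ₀ x (E4.basisVector 0)))) →
    (∀ (X : Type) [TopologicalSpace X] [ChartedSpace E3 X] [IsManifold (𝓡 3) ∞ X] [T2Space X]
      [SecondCountableTopology X] [ConnectedSpace X],
      ∀ D ∈ admissibleVacuumData X, ∀ 𝒟 : VacuumCauchyDevelopment D, 𝒟.IsMaximal →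
        ∀ (O : Set 𝒟.carrier) (τ₀ : ℝ) (U₀ : Opens E4) (Ψ₀ : U₀ → 𝒟.carrier),
          (𝒟.toSpacetime.IsLateChart (Minkowski.backgroundOn U₀) O τ₀ Ψ₀ ∧
            {x : E4 | τ₀ < x 0} ⊆ (U₀ : Set E4) ∧
            O = Summit.FinalStateConjecture.exteriorOf 𝒟.toCauchyDevelopment
              (Ψ₀ '' (Minkowski.backgroundOn U₀).lateRegion τ₀) ∧
            (∀ τ₁ : ℝ, τ₀ < τ₁ → O \ Ψ₀ '' (Minkowski.backgroundOn U₀).lateRegion τ₁ ⊆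
              𝒟.metric.causalPast 𝒟.timeOrientation
                (Ψ₀ '' (Minkowski.backgroundOn U₀).timeSlab τ₁)) ∧
            (∀ τ : ℝ, τ₀ < τ → 𝒟.toSpacetime.deviationCk (Minkowski.backgroundOn U₀) Ψ₀ 0 τ ≤
              ENNReal.ofReal (1 / 4))) →
          (𝒟.metric.chronologicalFuture 𝒟.timeOrientation
              (Ψ₀ '' (Minkowski.backgroundOn U₀).lateRegion τ₀) ⊆
            Ψ₀ '' (Minkowski.backgroundOn U₀).lateRegion τ₀) ∧
          (∀ τ : ℝ, τ₀ < τ →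
            𝒟.metric.chronologicalFuture 𝒟.timeOrientation
                (Ψ₀ '' (Minkowski.backgroundOn U₀).timeSlab τ) ⊆
              Ψ₀ '' (Minkowski.backgroundOn U₀).lateRegion τ)) →
    ∀ (X : Type) [TopologicalSpace X] [ChartedSpace E3 X] [IsManifold (𝓡 3) ∞ X] [T2Space X]
      [SecondCountableTopology X] [ConnectedSpace X],
      ∀ D ∈ admissibleVacuumData X, ∀ 𝒟 : VacuumCauchyDevelopment D, 𝒟.IsMaximal →
        ∀ (O : Set 𝒟.carrier) (τ₀ : ℝ) (U₀ : Opens E4) (Ψ₀ : U₀ → 𝒟.carrier),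
          (𝒟.toSpacetime.IsLateChart (Minkowski.backgroundOn U₀) O τ₀ Ψ₀ ∧
            {x : E4 | τ₀ < x 0} ⊆ (U₀ : Set E4) ∧
            O = Summit.FinalStateConjecture.exteriorOf 𝒟.toCauchyDevelopment
              (Ψ₀ '' (Minkowski.backgroundOn U₀).lateRegion τ₀) ∧
            (∀ τ₁ : ℝ, τ₀ < τ₁ → O \ Ψ₀ '' (Minkowski.backgroundOn U₀).lateRegion τ₁ ⊆
              𝒟.metric.causalPast 𝒟.timeOrientation
                (Ψ₀ '' (Minkowski.backgroundOn U₀).timeSlab τ₁)) ∧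
            (∀ τ : ℝ, τ₀ < τ → 𝒟.toSpacetime.deviationCk (Minkowski.backgroundOn U₀) Ψ₀ 0 τ ≤
              ENNReal.ofReal (1 / 4))) →
          (∀ τ : ℝ, τ₀ < τ →
            ∀ (γ : ℝ → 𝒟.carrier) (s : Set ℝ), s.OrdConnected →
              𝒟.metric.IsFutureCausalCurveOn 𝒟.timeOrientation γ s → IsPastEndless γ s →
              ∀ t ∈ s, γ t ∈ Ψ₀ '' (Minkowski.backgroundOn U₀).lateRegion τ →
                ∃ t' ∈ s, t' ≤ t ∧ γ t' ∈ Ψ₀ '' (Minkowski.backgroundOn U₀).timeSlab τ) := by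
  intro hA hCF _ X _ _ _ _ _ _ D hD 𝒟 hmax O τ₀ U₀ Ψ₀ hyp τ hτ γ s hs hγ hend t ht hγt
  -- the pointwise anchor and the orientation of the chart time (neighbours, hypotheses 1 and 2)
  have hdev : ∀ y : U₀, τ₀ < y.1 0 →
      ‖𝒟.toSpacetime.deviation (Minkowski.backgroundOn U₀) Ψ₀ y‖ ≤ 1 / 4 :=
    hA X D hD 𝒟 hmax O τ₀ U₀ Ψ₀ hyp
  have hfut : ∀ y : U₀, τ₀ < y.1 0 →
      𝒟.timeOrientation.IsFutureDirected (mfderiv 𝓘(ℝ, E4) (𝓡 4) Ψ₀ y (E4.basisVector 0)) :=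
    hCF X D hD 𝒟 hmax O τ₀ U₀ Ψ₀ hyp
  obtain ⟨hchart, hU, hO, -, -⟩ := hyp
  -- the late half-space `V` and the chart `Φ = Ψ₀|V` (as for the neighbour `stub_futureSet`)
  obtain ⟨V, hVmem⟩ : ∃ V : Opens E4, ∀ p : E4, p ∈ V ↔ τ₀ < p 0 :=
    ⟨⟨{x : E4 | τ₀ < x 0}, isOpen_lt continuous_const (PiLp.continuous_apply 2 _ 0)⟩,
      fun _ ↦ Iff.rfl⟩
  have hVU : V ≤ U₀ := fun p hp ↦ hU ((hVmem p).1 hp)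
  haveI : Nonempty V :=
    ⟨⟨(τ₀ + 1) • (E4.basisVector 0 : E4), (hVmem _).2 (by simp [E4.basisVector])⟩⟩
  have hlate : ∀ x : V, τ₀ < (Opens.inclusion hVU x).1 0 := fun x ↦ (hVmem x.1).1 x.2
  set Φ : V → 𝒟.carrier := Ψ₀ ∘ Opens.inclusion hVU with hΦdef
  have hΨs : ContMDiff 𝓘(ℝ, E4) (𝓡 4) ∞ Ψ₀ := hchart.contMDiff
  have hΦs : ContMDiff 𝓘(ℝ, E4) (𝓡 4) ∞ Φ := hΨs.comp (contMDiff_inclusion hVU)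
  have hdΦ : ∀ x : V, mfderiv 𝓘(ℝ, E4) (𝓡 4) Φ x =
      mfderiv 𝓘(ℝ, E4) (𝓡 4) Ψ₀ (Opens.inclusion hVU x) := fun x ↦
    FutureSet.mfderiv_comp_inclusion hVU x (hΨs.mdifferentiableAt (by simp))
  have hinj : Injective Φ := by
    intro x₁ x₂ h
    have h' : (⟨Opens.inclusion hVU x₁, hlate x₁⟩ :
        (Minkowski.backgroundOn U₀).lateRegion τ₀) = ⟨Opens.inclusion hVU x₂, hlate x₂⟩ :=
      hchart.isOpenEmbedding.injective h
    exact Subtype.ext (congrArg (fun y : (Minkowski.backgroundOn U₀).lateRegion τ₀ ↦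
      (y.1 : E4)) h')
  have hloc : IsLocalDiffeomorph 𝓘(ℝ, E4) (𝓡 4) ∞ Φ := fun x ↦ by
    have hinjd : Injective (mfderiv 𝓘(ℝ, E4) (𝓡 4) Φ x) := by
      rw [hdΦ x]
      exact FutureSet.mfderiv_injective_of_deviation Ψ₀ _ (hdev _ (hlate x))
    set A : E4 →L[ℝ] E4 := mfderiv 𝓘(ℝ, E4) (𝓡 4) Φ x with hA
    have hinjA : Injective (A : E4 →ₗ[ℝ] E4) := hinjd
    have hbij : Bijective (A : E4 →ₗ[ℝ] E4) :=
      ⟨hinjA, LinearMap.injective_iff_surjective.1 hinjA⟩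
    set e : E4 ≃L[ℝ] E4 := (LinearEquiv.ofBijective (A : E4 →ₗ[ℝ] E4) hbij).toContinuousLinearEquiv
      with he
    exact Literature.Geometry.Manifold.isLocalDiffeomorphAt_of_mfderiv (by simp) isOpen_univ
      (mem_univ x) hΦs.contMDiffOn e (by ext v; rfl)
  have hcone : ∀ (x : V) (w : E4),
      𝒟.timeOrientation.IsFutureDirected (mfderiv 𝓘(ℝ, E4) (𝓡 4) Φ x w) →
      0 < w 0 ∧ ‖w‖ < 2 * w 0 := by
    intro x w hf
    rw [hdΦ x] at hf
    exact SlabCauchy.cone_of_deviation_causal Ψ₀ (Opens.inclusion hVU x) (hdev _ (hlate x))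
      (hfut _ (hlate x)) w hf
  -- the chart above the slab, `W_τ = Ψ₀{x⁰ > τ} = Φ{x⁰ > τ}`, is open
  have hWiff : ∀ q : 𝒟.carrier, q ∈ Ψ₀ '' (Minkowski.backgroundOn U₀).lateRegion τ ↔
      ∃ x : V, Φ x = q ∧ τ < (x : E4) 0 := by
    intro q
    constructor
    · rintro ⟨y, hy, rfl⟩
      have hy' : τ < (y : E4) 0 := hy
      exact ⟨⟨y.1, (hVmem _).2 (hτ.trans hy')⟩, congrArg Ψ₀ (Subtype.ext rfl), hy'⟩
    · rintro ⟨x, rfl, hx⟩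
      exact ⟨Opens.inclusion hVU x, hx, rfl⟩
  have hWopen : IsOpen (Ψ₀ '' (Minkowski.backgroundOn U₀).lateRegion τ) := by
    have h1 : Ψ₀ '' (Minkowski.backgroundOn U₀).lateRegion τ = Φ '' {x : V | τ < (x : E4) 0} := by
      ext q
      rw [hWiff q]
      exact ⟨fun ⟨x, hx, hxτ⟩ ↦ ⟨x, hxτ, hx⟩, fun ⟨x, hxτ, hx⟩ ↦ ⟨x, hx, hxτ⟩⟩
    rw [h1]
    exact hloc.isOpenMap _ (isOpen_lt continuous_const
      ((PiLp.continuous_apply 2 (fun _ : Fin 4 ↦ ℝ) 0).comp continuous_subtype_val))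
  by_cases hall : ∀ u ∈ s, u ≤ t → γ u ∈ Ψ₀ '' (Minkowski.backgroundOn U₀).lateRegion τ
  · -- CASE (b): the whole past ray `s ∩ (-∞, t]` is charted above the slab — read backwards it
    -- is a future-endless causal curve for `-T` imprisoned in the compact `J⁻(γ t) ∩ J⁺(Σ)`
    exfalso
    set P : Set ℝ := s ∩ Iic t with hP
    have hPend : IsPastEndless γ P := hend.inter_Iic ht
    have hPoc : P.OrdConnected := hs.inter ordConnected_Iic
    have hγP : 𝒟.metric.IsFutureCausalCurveOn 𝒟.timeOrientation γ P := hγ.mono inter_subset_left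
    have hcurve : 𝒟.metric.IsFutureCausalCurveOn 𝒟.timeOrientation.reverse (γ ∘ Neg.neg)
        (Neg.neg ⁻¹' P) := hγP.comp_neg
    have hend' : IsFutureEndless (γ ∘ Neg.neg) (Neg.neg ⁻¹' P) :=
      isFutureEndless_comp_neg_iff.mpr hPend
    have hsc : 𝒟.metric.IsStronglyCausal 𝒟.timeOrientation.reverse :=
      LorentzianMetric.bernalSanchez_isStronglyCausal_of_isGloballyHyperbolic_holds 𝒟.metric
        𝒟.timeOrientation.reverse two_le_infty
        𝒟.toCauchyDevelopment.isGloballyHyperbolic.reverse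
    obtain ⟨v₁, hv₁, hout⟩ :=
      LorentzianMetric.IsStronglyCausal.exists_forall_notMem_of_isCompact_holds
        two_le_infty hsc
        (𝒟.toCauchyDevelopment.isCompact_causalPast_inter_causalFuture_range (γ t))
        (ordConnected_preimage_neg hPoc) hcurve hend'
    have hv₁P : -v₁ ∈ P := hv₁
    refine hout v₁ hv₁ le_rfl ⟨?_, ?_⟩
    · -- `γ(-v₁) ∈ J⁻(γ t)` along `γ|[-v₁, t]`
      show γ (-v₁) ∈ 𝒟.metric.causalPast 𝒟.timeOrientation {γ t}
      rcases eq_or_lt_of_le (show -v₁ ≤ t from hv₁P.2) with h | h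
      · rw [h]
        exact LorentzianMetric.subset_causalPast _ _ _ (mem_singleton _)
      · exact LorentzianMetric.mem_causalPast_singleton_iff.2
          (Or.inr ⟨γ (-v₁), rfl, γ, -v₁, t, h, hγ.mono (hs.out hv₁P.1 ht), rfl, rfl⟩)
    · -- `γ(-v₁) ∈ W_τ ⊆ W ⊆ O ⊆ J⁺(Σ)`
      show γ (-v₁) ∈ 𝒟.metric.causalFuture 𝒟.timeOrientation (range 𝒟.embed)
      have h1 : γ (-v₁) ∈ Ψ₀ '' (Minkowski.backgroundOn U₀).lateRegion τ₀ :=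
        image_mono ((Minkowski.backgroundOn U₀).lateRegion_mono hτ.le) (hall (-v₁) hv₁P.1 hv₁P.2)
      have h2 : γ (-v₁) ∈ O := hchart.image_subset h1
      rw [hO] at h2
      exact h2.1
  · -- CASE (a): the last parameter `σ ≤ t` at which `γ` is not charted above the slab
    push Not at hall
    obtain ⟨u₀, hu₀s, hu₀t, hu₀W⟩ := hall
    set B : Set ℝ := {u | u ∈ s ∧ u ≤ t ∧ γ u ∉ Ψ₀ '' (Minkowski.backgroundOn U₀).lateRegion τ}
      with hB
    have hBne : B.Nonempty := ⟨u₀, hu₀s, hu₀t, hu₀W⟩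
    have hBbdd : BddAbove B := ⟨t, fun u hu ↦ hu.2.1⟩
    set σ : ℝ := sSup B with hσ
    have hσt : σ ≤ t := csSup_le hBne fun u hu ↦ hu.2.1
    have hu₀σ : u₀ ≤ σ := le_csSup hBbdd ⟨hu₀s, hu₀t, hu₀W⟩
    have hσs : σ ∈ s := hs.out hu₀s ht ⟨hu₀σ, hσt⟩
    -- `γ σ` is not charted above the slab (openness, continuity, `σ = sup B`)
    have hσW : γ σ ∉ Ψ₀ '' (Minkowski.backgroundOn U₀).lateRegion τ := by
      intro hσW
      have hn : γ ⁻¹' (Ψ₀ '' (Minkowski.backgroundOn U₀).lateRegion τ) ∈ 𝓝 σ :=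
        (hγ.continuousAt hσs).preimage_mem_nhds (hWopen.mem_nhds hσW)
      obtain ⟨δ, hδ, hball⟩ := Metric.mem_nhds_iff.1 hn
      obtain ⟨u, huB, hu⟩ := exists_lt_of_lt_csSup hBne (show σ - δ < σ by linarith)
      have huσ : u ≤ σ := le_csSup hBbdd huB
      have hub : u ∈ Metric.ball σ δ := by
        rw [Metric.mem_ball, Real.dist_eq, abs_sub_lt_iff]
        constructor <;> linarith
      exact huB.2.2 (hball hub)
    have hσt' : σ < t := lt_of_le_of_ne hσt fun h ↦ hσW (h ▸ hγt)
    have hIs : Ioc σ t ⊆ s := fun u hu ↦ hs.out hσs ht ⟨hu.1.le, hu.2⟩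
    have hin : ∀ u ∈ Ioc σ t, ∃ x : V, Φ x = γ u ∧ τ < (x : E4) 0 := fun u hu ↦ by
      refine (hWiff (γ u)).1 ?_
      by_contra h
      exact absurd (le_csSup hBbdd ⟨hIs hu, hu.2, h⟩) (not_le.2 hu.1)
    -- the lift converges as `u ↓ σ`: `γ σ = Φ x` with `x⁰ ≥ τ`, hence `x⁰ = τ`
    obtain ⟨x, hx, hxτ⟩ := SlabCauchy.exists_apply_eq_of_exit hΦs hinj hloc hcone hVmem hτ hσt'
      (hγ.mono hIs) hin (hγ.continuousAt hσs)
    have hx0 : (x : E4) 0 = τ := by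
      rcases hxτ.eq_or_lt with h | h
      · exact h.symm
      · exact absurd ((hWiff (γ σ)).2 ⟨x, hx, h⟩) hσW
    exact ⟨σ, hσs, hσt, Opens.inclusion hVU x, hx0, hx⟩

end Summit.FinalStateConjecture.FinalStateConjecture.Theorems.RecurrentlyFlatDisperses

end
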